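import Summits.QuantumFields.YangMills.Theorems.ColdStartUniversalityLatticeLangevinMixingTimeExplicit
import Summits.QuantumFields.YangMills.Theorems.ColdStartUniversalityLatticeLangevinWilsonLogSobolev
import Summits.QuantumFields.YangMills.Theorems.ColdStartUniversalityUniformColdStartMixingRungOfMixing
import HarnessLib

/-!
# Route `ColdStartUniversality` (fixed-cut-off package, explicit constants): EXPLICIT POINTWISE MIXING AND CESÀRO ERGODIC BOUNDS for the
# SU(2) SZZ dynamics on `(ℤ/L)³` at EVERY coupling, every start, every solution — the inputs (M)/(E3) of the rung `stub_fixedCutoffMixing`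
# with all constants explicit in `L` and `β'`

Helper file (seat `ym-line-csu-p1`, g27; `--supports stmt-QuantumFields-24809`).  g8 closed the rung `stub_fixedCutoffMixing` of the aside
crux K_A1 through (M) «pointwise mixing of the cold start at each fixed cut-off» (`fixedCutoffMixing_of_pointwiseMixing`) with Doeblin
constants that are only known to exist.  With the explicit entropy budget `B_L(β') = 366|β'|L³ + 3log(3/2)L³ + log 2` of
`…MixingTimeExplicit` and the explicit log-Sobolev rates (`(1/2)e^(−4|β'|#𝒫)` for every `β'`, g22; `(1−12|β'|)/2` in the window, g26):
* ★★ `wilson_coldStart_observable_le_exp_allCoupling_explicit` — EVERY `β'`, measurable `|g| ≤ 1`, every start `z`, every solution, `u ≥ 0`: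
  `|E g(U_(2+u)) − μ_(β')(g)| ≤ e^(−2ρ_L u) √(2B_L)`, `ρ_L = (1/2)e^(−4|β'|#𝒫)` (`#𝒫 = 3L³`);
* ★★ `wilson_coldStart_mixingTime_allCoupling_explicit` — `u ≥ log(√(2B_L)/ε)/(2ρ_L)` ⇒ `≤ ε`: (M) with the explicit threshold
  `t₀(L, β', ε) = 2 + log(√(2B_L)/ε)·e^(4|β'|·3L³)` (lattice units) — the honest size of the fixed-cut-off rung OUTSIDE the window;
* ★★★ `wilson_coldStart_cesaro_explicit` — in the window `|β'| < 1/12`: for `δ > 0`, `T_c = 2 + log(2√(2B_L)/δ)/(1 − 12|β'|)` and EVERY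
  `T ≥ T_c + 4T_c/δ`: `|∫ f dμ_(β') − T⁻¹ ∫₀ᵀ E f(U_t) dt| ≤ δ` (measurable `|f| ≤ 1`, every start, every solution) — an EXPLICIT ERGODIC
  THEOREM with `T_c = O((log L + log(1/δ)))` and `T = O(T_c/δ)`;
* ★★ `wilson_coldStart_cesaro_allCoupling_explicit` — the same at every `β'` with `1 − 12|β'|` replaced by `2ρ_L`.
(Cesàro bookkeeping `abs_sub_inv_mul_integral_le_of_le` and interval integrability `integrand_bound_and_intervalIntegrable` of g8.)
[cite: ShenZhuZhu2022, §4 Theorem 4.2, Corollary 4.4]  THEOREMS ONLY, no definition, no sorry.  HONEST FRAMING: FIXED cut-off (lattice units);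
explicit but, outside `|β'| < 1/12`, super-exponentially bad in the volume; the route's scaling `β'_K → ∞` is exactly that regime; 24809 ASIDE
not restated; no crux, rung or summit statement is proved; the Yang–Mills mass gap is NOT proved.
-/

set_option autoImplicit false

noncomputable section

namespace Summit.QuantumFields.YangMills.Theorems.ColdStartUniversality

open MeasureTheory ProbabilityTheory Finset Filter Set InformationTheory intervalIntegral
open scoped BigOperators NNReal ENNReal Topology
open Literature.Probability.Process Literature.MathematicalPhysics.QuantumFieldTheory
open Literature.MathematicalPhysics.QuantumLattice (fundamentalRep fundamentalLatticeRep continuous_fundamentalRep)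

variable {L : ℕ} [NeZero L]

/-! ## §1. Every coupling: explicit pointwise mixing with the Holley–Stroock rate -/

/-- ★★ **Explicit cold-start mixing of bounded observables at EVERY coupling** (SU(2) SZZ dynamics on `(ℤ/L)³`): for measurable `|g| ≤ 1`,
every deterministic start, every solution and every `u ≥ 0`, `|E g(U_(2+u)) − ∫ g dμ_(β')| ≤ e^(−2ρ_L u)·√(2B_L)`,
`ρ_L = (1/2)e^(−4|β'|#𝒫)`, `B_L = 366|β'|L³ + 3log(3/2)L³ + log 2`. [cite: BakryGentilLedoux2014, Thm 5.2.1] -/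
theorem wilson_coldStart_observable_le_exp_allCoupling_explicit (L : ℕ) [NeZero L] (β' : ℝ) (z : (GaugeConfig 3 L (Matrix.specialUnitaryGroup (Fin 2) ℂ)))
    {Ω : Type} [MeasurableSpace Ω] {P : Measure Ω} [IsProbabilityMeasure P]
    {W : ℝ≥0 → Ω → (Edge 3 L × NoiseIdx 2 → ℝ)} (hW : IsFlatBrownian W P)
    {U : ℝ≥0 → Ω → (GaugeConfig 3 L (Matrix.specialUnitaryGroup (Fin 2) ℂ))} (hU0 : ∀ ω, U 0 ω = z)
    (hU : (latticeLangevinDynamics (fundamentalLatticeRep 2) β').IsSolution (fundamentalRep (Fin 2)) hW.natFiltration P W U)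
    (u : ℝ≥0) {g : (GaugeConfig 3 L (Matrix.specialUnitaryGroup (Fin 2) ℂ)) → ℝ} (hgm : Measurable g) (hgb : ∀ x, |g x| ≤ 1) :
    |(∫ ω, g (U ((2 : ℝ≥0) + u) ω) ∂P) - ∫ x, g x ∂(wilsonMeasure (d := 3) (L := L) (fundamentalRep (Fin 2)) β')| ≤
      Real.exp (-(2 * ((1 / 2 : ℝ) * Real.exp (-(|β'| * (4 * (Fintype.card (Plaquette 3 L) : ℝ)))))) * u) * Real.sqrt (2 * (366 * |β'| * (L : ℝ) ^ 3 + 3 * Real.log (3 / 2) * (L : ℝ) ^ 3 + Real.log 2)) := by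
  classical
  haveI := secondCountableTopology_su2
  haveI := borelSpace_config L
  haveI : IsProbabilityMeasure (wilsonMeasure (d := 3) (L := L) (fundamentalRep (Fin 2)) β') :=
    isProbabilityMeasure_wilsonMeasure (d := 3) (L := L) (fundamentalRep (Fin 2)) (continuous_fundamentalRep (Fin 2)) β'
  have hmU : ∀ t : ℝ≥0, Measurable (U t) := fun t => (hU.adapted t).mono (hW.natFiltration.le t) le_rfl
  haveI : IsProbabilityMeasure (P.map (U ((2 : ℝ≥0) + u))) := Measure.isProbabilityMeasure_map (hmU _).aemeasurable
  have ht₁ : 0 < ((2 : ℝ≥0) : ℝ) := by norm_num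
  have hdec := wilson_klDiv_map_le_exp_explicit L β' hW z hU0 hU ht₁ u
  have hb := wilson_klDiv_map_le_explicit L β' z hW hU0 hU 0
  rw [add_zero] at hb
  have hBpos := burnInBudget_pos L β'
  have hK0 : 0 ≤ (klDiv (P.map (U (2 : ℝ≥0))) (wilsonMeasure (d := 3) (L := L) (fundamentalRep (Fin 2)) β')).toReal := ENNReal.toReal_nonneg
  have hK : (klDiv (P.map (U (2 : ℝ≥0))) (wilsonMeasure (d := 3) (L := L) (fundamentalRep (Fin 2)) β')).toReal ≤ (366 * |β'| * (L : ℝ) ^ 3 + 3 * Real.log (3 / 2) * (L : ℝ) ^ 3 + Real.log 2) := by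
    have h := ENNReal.toReal_mono ENNReal.ofReal_ne_top hb
    rwa [ENNReal.toReal_ofReal hBpos.le] at h
  have hfin : klDiv (P.map (U ((2 : ℝ≥0) + u))) (wilsonMeasure (d := 3) (L := L) (fundamentalRep (Fin 2)) β') ≠ ∞ := ne_top_of_le_ne_top ENNReal.ofReal_ne_top hdec
  have hP := abs_integral_sub_integral_le_sqrt_two_mul_klDiv hfin hgm hgb
  rw [integral_map (hmU _).aemeasurable hgm.aestronglyMeasurable] at hP
  refine hP.trans ?_
  -- abstract the rate
  obtain ⟨ρ, hρdef⟩ : ∃ ρ : ℝ, ((1 / 2 : ℝ) * Real.exp (-(|β'| * (4 * (Fintype.card (Plaquette 3 L) : ℝ))))) = ρ := ⟨_, rfl⟩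
  rw [hρdef] at hdec ⊢
  have hle : (klDiv (P.map (U ((2 : ℝ≥0) + u))) (wilsonMeasure (d := 3) (L := L) (fundamentalRep (Fin 2)) β')).toReal ≤ Real.exp (-4 * ρ * u) * (366 * |β'| * (L : ℝ) ^ 3 + 3 * Real.log (3 / 2) * (L : ℝ) ^ 3 + Real.log 2) := by
    have h := ENNReal.toReal_mono ENNReal.ofReal_ne_top hdec
    rw [ENNReal.toReal_ofReal (mul_nonneg (Real.exp_pos _).le hK0)] at h
    exact h.trans (mul_le_mul_of_nonneg_left hK (Real.exp_pos _).le)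
  have hsq : Real.sqrt (2 * (klDiv (P.map (U ((2 : ℝ≥0) + u))) (wilsonMeasure (d := 3) (L := L) (fundamentalRep (Fin 2)) β')).toReal) ≤ Real.sqrt (2 * (Real.exp (-4 * ρ * u) * (366 * |β'| * (L : ℝ) ^ 3 + 3 * Real.log (3 / 2) * (L : ℝ) ^ 3 + Real.log 2))) :=
    Real.sqrt_le_sqrt (by linarith)
  refine hsq.trans (le_of_eq ?_)
  have hexp : Real.exp (-4 * ρ * (u : ℝ)) = Real.exp (-(2 * ρ) * u) * Real.exp (-(2 * ρ) * u) := by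
    rw [← Real.exp_add]; congr 1; ring
  rw [hexp, show 2 * (Real.exp (-(2 * ρ) * (u : ℝ)) * Real.exp (-(2 * ρ) * u) * (366 * |β'| * (L : ℝ) ^ 3 + 3 * Real.log (3 / 2) * (L : ℝ) ^ 3 + Real.log 2)) =
      (Real.exp (-(2 * ρ) * u)) ^ 2 * (2 * (366 * |β'| * (L : ℝ) ^ 3 + 3 * Real.log (3 / 2) * (L : ℝ) ^ 3 + Real.log 2)) by ring,
    Real.sqrt_mul' _ (by linarith), Real.sqrt_sq (Real.exp_pos _).le]

/-- ★★ **Explicit mixing time at EVERY coupling** ((M) of the rung, quantitatively): for `ε > 0` and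
`u ≥ log(√(2B_L)/ε)/(2ρ_L)`, `|E g(U_(2+u)) − ∫ g dμ_(β')| ≤ ε` for all measurable `|g| ≤ 1`, starts and solutions
(`2ρ_L = e^(−4|β'|·3L³)`: super-exponential in the volume outside the strong-coupling window — the honest size of the fixed-cut-off rung).
[cite: BakryGentilLedoux2014, Thm 5.2.1] -/
theorem wilson_coldStart_mixingTime_allCoupling_explicit (L : ℕ) [NeZero L] (β' : ℝ) (z : (GaugeConfig 3 L (Matrix.specialUnitaryGroup (Fin 2) ℂ)))
    {Ω : Type} [MeasurableSpace Ω] {P : Measure Ω} [IsProbabilityMeasure P]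
    {W : ℝ≥0 → Ω → (Edge 3 L × NoiseIdx 2 → ℝ)} (hW : IsFlatBrownian W P)
    {U : ℝ≥0 → Ω → (GaugeConfig 3 L (Matrix.specialUnitaryGroup (Fin 2) ℂ))} (hU0 : ∀ ω, U 0 ω = z)
    (hU : (latticeLangevinDynamics (fundamentalLatticeRep 2) β').IsSolution (fundamentalRep (Fin 2)) hW.natFiltration P W U)
    {ε : ℝ} (hε : 0 < ε) (u : ℝ≥0)
    (hu : Real.log (Real.sqrt (2 * (366 * |β'| * (L : ℝ) ^ 3 + 3 * Real.log (3 / 2) * (L : ℝ) ^ 3 + Real.log 2)) / ε) / (2 * ((1 / 2 : ℝ) * Real.exp (-(|β'| * (4 * (Fintype.card (Plaquette 3 L) : ℝ)))))) ≤ (u : ℝ))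
    {g : (GaugeConfig 3 L (Matrix.specialUnitaryGroup (Fin 2) ℂ)) → ℝ} (hgm : Measurable g) (hgb : ∀ x, |g x| ≤ 1) :
    |(∫ ω, g (U ((2 : ℝ≥0) + u) ω) ∂P) - ∫ x, g x ∂(wilsonMeasure (d := 3) (L := L) (fundamentalRep (Fin 2)) β')| ≤ ε := by
  have h := wilson_coldStart_observable_le_exp_allCoupling_explicit L β' z hW hU0 hU u hgm hgb
  obtain ⟨ρ, hρdef⟩ : ∃ ρ : ℝ, ((1 / 2 : ℝ) * Real.exp (-(|β'| * (4 * (Fintype.card (Plaquette 3 L) : ℝ))))) = ρ := ⟨_, rfl⟩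
  have hρ : 0 < 2 * ρ := by rw [← hρdef]; positivity
  rw [hρdef] at h hu
  have hBpos := burnInBudget_pos L β'
  set S : ℝ := Real.sqrt (2 * (366 * |β'| * (L : ℝ) ^ 3 + 3 * Real.log (3 / 2) * (L : ℝ) ^ 3 + Real.log 2)) with hS
  have hSpos : 0 < S := Real.sqrt_pos.2 (by linarith)
  refine h.trans ?_
  have hu' : Real.log (S / ε) ≤ (2 * ρ) * u := by
    rw [div_le_iff₀ hρ] at hu
    linarith
  have hexp : Real.exp (-(2 * ρ) * u) ≤ ε / S := by
    have h1 : Real.exp (-(2 * ρ) * u) ≤ Real.exp (-Real.log (S / ε)) := Real.exp_le_exp.2 (by linarith)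
    rw [Real.exp_neg, Real.exp_log (div_pos hSpos hε), inv_div] at h1
    exact h1
  calc Real.exp (-(2 * ρ) * u) * S ≤ ε / S * S := mul_le_mul_of_nonneg_right hexp hSpos.le
    _ = ε := div_mul_cancel₀ ε hSpos.ne'

/-! ## §2. Explicit Cesàro (ergodic) bounds -/

/-- Lattice times: `2 + (s − 2)⁺ = s⁺` for `s ≥ 2` in `ℝ≥0`. [folklore] -/
theorem two_add_toNNReal_sub_two {s : ℝ} (hs : 2 ≤ s) : (2 : ℝ≥0) + (s - 2).toNNReal = s.toNNReal := by
  apply NNReal.eq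
  rw [NNReal.coe_add, Real.coe_toNNReal _ (by linarith), Real.coe_toNNReal _ (by linarith)]
  push_cast
  ring

/-- `|T⁻¹ ∫₀ᵀ g| ≤ 1` for `|g| ≤ 1` (any real `T`). [folklore] -/
theorem abs_inv_mul_intervalIntegral_le_one {g : ℝ → ℝ} (hg : ∀ s, |g s| ≤ 1) (T : ℝ) :
    |T⁻¹ * ∫ s in (0 : ℝ)..T, g s| ≤ 1 := by
  rcases eq_or_ne T 0 with hT | hT
  · rw [hT]; simp
  · have h := intervalIntegral.norm_integral_le_of_norm_le_const (a := (0 : ℝ)) (b := T) (C := 1) (f := g)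
      (fun s _ => by rw [Real.norm_eq_abs]; exact hg s)
    rw [Real.norm_eq_abs, sub_zero, one_mul] at h
    rw [abs_mul, abs_inv]
    calc |T|⁻¹ * |∫ s in (0 : ℝ)..T, g s| ≤ |T|⁻¹ * |T| := mul_le_mul_of_nonneg_left h (inv_nonneg.2 (abs_nonneg _))
      _ = 1 := inv_mul_cancel₀ (abs_ne_zero.2 hT)

/-- `1 < √(2 B_L)`. [folklore] -/
theorem one_lt_sqrt_two_mul_budget (L : ℕ) [NeZero L] (β' : ℝ) : 1 < Real.sqrt (2 * (366 * |β'| * (L : ℝ) ^ 3 + 3 * Real.log (3 / 2) * (L : ℝ) ^ 3 + Real.log 2)) := by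
  have h1 : (1 : ℝ) / 2 < Real.log 2 := by have := Real.log_two_gt_d9; linarith
  have h2 : 0 < Real.log (3 / 2 : ℝ) := Real.log_pos (by norm_num)
  have h3 : (0 : ℝ) ≤ 366 * |β'| * (L : ℝ) ^ 3 := by positivity
  have h4 : (0 : ℝ) ≤ 3 * Real.log (3 / 2) * (L : ℝ) ^ 3 := by positivity
  rw [show (1 : ℝ) = Real.sqrt 1 from Real.sqrt_one.symm]
  exact Real.sqrt_lt_sqrt (by norm_num) (by linarith)

/-- ★★★ **Explicit ergodic theorem for the cold (or any deterministic) start in the strong-coupling window.**  For the SU(2) SZZ dynamics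
on `(ℤ/L)³` at `|β'| < 1/12`, measurable `|f| ≤ 1`, `δ > 0`, with `T_c = 2 + log(2√(2B_L)/δ)/(1 − 12|β'|)`
(`B_L = 366|β'|L³ + 3log(3/2)L³ + log 2`): for EVERY solution from any deterministic start and EVERY real `T ≥ T_c + 4T_c/δ`,
`|∫ f dμ_(β') − T⁻¹ ∫₀ᵀ E f(U_t) dt| ≤ δ` (lattice time). [cite: ShenZhuZhu2022, §4 Theorem 4.2, Corollary 4.4] -/
theorem wilson_coldStart_cesaro_explicit (L : ℕ) [NeZero L] (β' : ℝ) (hβ : |β'| < 1 / 12) (z : (GaugeConfig 3 L (Matrix.specialUnitaryGroup (Fin 2) ℂ)))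
    {Ω : Type} [MeasurableSpace Ω] {P : Measure Ω} [IsProbabilityMeasure P]
    {W : ℝ≥0 → Ω → (Edge 3 L × NoiseIdx 2 → ℝ)} (hW : IsFlatBrownian W P)
    {U : ℝ≥0 → Ω → (GaugeConfig 3 L (Matrix.specialUnitaryGroup (Fin 2) ℂ))} (hU0 : ∀ ω, U 0 ω = z)
    (hU : (latticeLangevinDynamics (fundamentalLatticeRep 2) β').IsSolution (fundamentalRep (Fin 2)) hW.natFiltration P W U)
    {f : (GaugeConfig 3 L (Matrix.specialUnitaryGroup (Fin 2) ℂ)) → ℝ} (hfm : Measurable f) (hfb : ∀ V, |f V| ≤ 1) {δ : ℝ} (hδ : 0 < δ) {T : ℝ}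
    (hT : (2 + Real.log (2 * Real.sqrt (2 * (366 * |β'| * (L : ℝ) ^ 3 + 3 * Real.log (3 / 2) * (L : ℝ) ^ 3 + Real.log 2)) / δ) / (1 - 12 * |β'|)) +
        4 * (2 + Real.log (2 * Real.sqrt (2 * (366 * |β'| * (L : ℝ) ^ 3 + 3 * Real.log (3 / 2) * (L : ℝ) ^ 3 + Real.log 2)) / δ) / (1 - 12 * |β'|)) / δ ≤ T) :
    |(∫ V, f V ∂(wilsonMeasure (d := 3) (L := L) (fundamentalRep (Fin 2)) β')) - T⁻¹ * ∫ t in (0 : ℝ)..T, (∫ ω, f (U t.toNNReal ω) ∂P)| ≤ δ := by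
  have hρ : 0 < 1 - 12 * |β'| := by linarith
  have hBpos := burnInBudget_pos L β'
  obtain ⟨S, hSdef⟩ : ∃ S : ℝ, Real.sqrt (2 * (366 * |β'| * (L : ℝ) ^ 3 + 3 * Real.log (3 / 2) * (L : ℝ) ^ 3 + Real.log 2)) = S := ⟨_, rfl⟩
  have hS1 : 1 < S := by rw [← hSdef]; exact one_lt_sqrt_two_mul_budget L β'
  have hSpos : 0 < S := by linarith
  rw [hSdef] at hT
  obtain ⟨hgb, hgi⟩ := integrand_bound_and_intervalIntegrable hW hU hfm hfb
  have he1 : |∫ V, f V ∂(wilsonMeasure (d := 3) (L := L) (fundamentalRep (Fin 2)) β')| ≤ 1 := by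
    haveI := isProbabilityMeasure_wilsonMeasure (d := 3) (L := L) (G := Matrix.specialUnitaryGroup (Fin 2) ℂ)
      (fundamentalRep (Fin 2)) (continuous_fundamentalRep (Fin 2)) β'
    have h := norm_integral_le_of_norm_le_const (μ := (wilsonMeasure (d := 3) (L := L) (fundamentalRep (Fin 2)) β'))
      (ae_of_all _ fun V => (show ‖f V‖ ≤ 1 by rw [Real.norm_eq_abs]; exact hfb V))
    rw [Real.norm_eq_abs, probReal_univ, mul_one] at h
    exact h
  by_cases hdeg : 2 * S / δ < 1
  · -- degenerate accuracy `δ > 2S > 2`: the trivial bound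
    have hδ2 : 2 < δ := by
      rw [div_lt_one hδ] at hdeg
      linarith
    have havg := abs_inv_mul_intervalIntegral_le_one hgb T
    calc |(∫ V, f V ∂(wilsonMeasure (d := 3) (L := L) (fundamentalRep (Fin 2)) β')) - T⁻¹ * ∫ t in (0 : ℝ)..T, (∫ ω, f (U t.toNNReal ω) ∂P)|
        ≤ |∫ V, f V ∂(wilsonMeasure (d := 3) (L := L) (fundamentalRep (Fin 2)) β')| + |T⁻¹ * ∫ t in (0 : ℝ)..T, (∫ ω, f (U t.toNNReal ω) ∂P)| := abs_sub _ _
      _ ≤ δ := by linarith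
  · -- the mixing threshold `T_c ≥ 2`
    have hlog : 0 ≤ Real.log (2 * S / δ) := Real.log_nonneg (not_lt.1 hdeg)
    set Tc : ℝ := 2 + Real.log (2 * S / δ) / (1 - 12 * |β'|) with hTc
    have hTc2 : 2 ≤ Tc := by rw [hTc]; linarith [div_nonneg hlog hρ.le]
    have hTcpos : 0 < Tc := by linarith
    have hmix : ∀ s : ℝ, Tc ≤ s → |(∫ V, f V ∂(wilsonMeasure (d := 3) (L := L) (fundamentalRep (Fin 2)) β')) - ∫ ω, f (U s.toNNReal ω) ∂P| ≤ δ / 2 := by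
      intro s hs
      have hs2 : 2 ≤ s := hTc2.trans hs
      have hu : Real.log (Real.sqrt (2 * (366 * |β'| * (L : ℝ) ^ 3 + 3 * Real.log (3 / 2) * (L : ℝ) ^ 3 + Real.log 2)) / (δ / 2)) / (1 - 12 * |β'|) ≤ ((s - 2).toNNReal : ℝ) := by
        rw [Real.coe_toNNReal _ (by linarith), hSdef]
        have e : S / (δ / 2) = 2 * S / δ := by field_simp
        rw [e]
        have : Tc - 2 = Real.log (2 * S / δ) / (1 - 12 * |β'|) := by rw [hTc]; ring
        linarith
      have h := wilson_coldStart_mixingTime_log_volume L β' hβ z hW hU0 hU (half_pos hδ) ((s - 2).toNNReal) hu hfm hfb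
      rw [two_add_toNNReal_sub_two hs2] at h
      rw [abs_sub_comm]
      exact h
    exact abs_sub_inv_mul_integral_le_of_le hTcpos hδ le_rfl he1 hgb hgi hmix hT

/-- ★★ **Explicit ergodic theorem at EVERY coupling** (Holley–Stroock rate): as `wilson_coldStart_cesaro_explicit` with
`1 − 12|β'|` replaced by `2ρ_L = e^(−4|β'|#𝒫)`: `T_c = 2 + log(2√(2B_L)/δ)/(2ρ_L)`, every `T ≥ T_c + 4T_c/δ`.
[cite: BakryGentilLedoux2014, Thm 5.2.1] -/
theorem wilson_coldStart_cesaro_allCoupling_explicit (L : ℕ) [NeZero L] (β' : ℝ) (z : (GaugeConfig 3 L (Matrix.specialUnitaryGroup (Fin 2) ℂ)))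
    {Ω : Type} [MeasurableSpace Ω] {P : Measure Ω} [IsProbabilityMeasure P]
    {W : ℝ≥0 → Ω → (Edge 3 L × NoiseIdx 2 → ℝ)} (hW : IsFlatBrownian W P)
    {U : ℝ≥0 → Ω → (GaugeConfig 3 L (Matrix.specialUnitaryGroup (Fin 2) ℂ))} (hU0 : ∀ ω, U 0 ω = z)
    (hU : (latticeLangevinDynamics (fundamentalLatticeRep 2) β').IsSolution (fundamentalRep (Fin 2)) hW.natFiltration P W U)
    {f : (GaugeConfig 3 L (Matrix.specialUnitaryGroup (Fin 2) ℂ)) → ℝ} (hfm : Measurable f) (hfb : ∀ V, |f V| ≤ 1) {δ : ℝ} (hδ : 0 < δ) {T : ℝ}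
    (hT : (2 + Real.log (2 * Real.sqrt (2 * (366 * |β'| * (L : ℝ) ^ 3 + 3 * Real.log (3 / 2) * (L : ℝ) ^ 3 + Real.log 2)) / δ) / (2 * ((1 / 2 : ℝ) * Real.exp (-(|β'| * (4 * (Fintype.card (Plaquette 3 L) : ℝ))))))) +
        4 * (2 + Real.log (2 * Real.sqrt (2 * (366 * |β'| * (L : ℝ) ^ 3 + 3 * Real.log (3 / 2) * (L : ℝ) ^ 3 + Real.log 2)) / δ) / (2 * ((1 / 2 : ℝ) * Real.exp (-(|β'| * (4 * (Fintype.card (Plaquette 3 L) : ℝ))))))) / δ ≤ T) :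
    |(∫ V, f V ∂(wilsonMeasure (d := 3) (L := L) (fundamentalRep (Fin 2)) β')) - T⁻¹ * ∫ t in (0 : ℝ)..T, (∫ ω, f (U t.toNNReal ω) ∂P)| ≤ δ := by
  obtain ⟨ρ, hρdef⟩ : ∃ ρ : ℝ, ((1 / 2 : ℝ) * Real.exp (-(|β'| * (4 * (Fintype.card (Plaquette 3 L) : ℝ))))) = ρ := ⟨_, rfl⟩
  have hρ : 0 < 2 * ρ := by rw [← hρdef]; positivity
  have hBpos := burnInBudget_pos L β'
  obtain ⟨S, hSdef⟩ : ∃ S : ℝ, Real.sqrt (2 * (366 * |β'| * (L : ℝ) ^ 3 + 3 * Real.log (3 / 2) * (L : ℝ) ^ 3 + Real.log 2)) = S := ⟨_, rfl⟩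
  have hS1 : 1 < S := by rw [← hSdef]; exact one_lt_sqrt_two_mul_budget L β'
  have hSpos : 0 < S := by linarith
  rw [hSdef, hρdef] at hT
  obtain ⟨hgb, hgi⟩ := integrand_bound_and_intervalIntegrable hW hU hfm hfb
  have he1 : |∫ V, f V ∂(wilsonMeasure (d := 3) (L := L) (fundamentalRep (Fin 2)) β')| ≤ 1 := by
    haveI := isProbabilityMeasure_wilsonMeasure (d := 3) (L := L) (G := Matrix.specialUnitaryGroup (Fin 2) ℂ)
      (fundamentalRep (Fin 2)) (continuous_fundamentalRep (Fin 2)) β'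
    have h := norm_integral_le_of_norm_le_const (μ := (wilsonMeasure (d := 3) (L := L) (fundamentalRep (Fin 2)) β'))
      (ae_of_all _ fun V => (show ‖f V‖ ≤ 1 by rw [Real.norm_eq_abs]; exact hfb V))
    rw [Real.norm_eq_abs, probReal_univ, mul_one] at h
    exact h
  by_cases hdeg : 2 * S / δ < 1
  · have hδ2 : 2 < δ := by
      rw [div_lt_one hδ] at hdeg
      linarith
    have havg := abs_inv_mul_intervalIntegral_le_one hgb T
    calc |(∫ V, f V ∂(wilsonMeasure (d := 3) (L := L) (fundamentalRep (Fin 2)) β')) - T⁻¹ * ∫ t in (0 : ℝ)..T, (∫ ω, f (U t.toNNReal ω) ∂P)|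
        ≤ |∫ V, f V ∂(wilsonMeasure (d := 3) (L := L) (fundamentalRep (Fin 2)) β')| + |T⁻¹ * ∫ t in (0 : ℝ)..T, (∫ ω, f (U t.toNNReal ω) ∂P)| := abs_sub _ _
      _ ≤ δ := by linarith
  · have hlog : 0 ≤ Real.log (2 * S / δ) := Real.log_nonneg (not_lt.1 hdeg)
    set Tc : ℝ := 2 + Real.log (2 * S / δ) / (2 * ρ) with hTc
    have hTc2 : 2 ≤ Tc := by rw [hTc]; linarith [div_nonneg hlog hρ.le]
    have hTcpos : 0 < Tc := by linarith
    have hmix : ∀ s : ℝ, Tc ≤ s → |(∫ V, f V ∂(wilsonMeasure (d := 3) (L := L) (fundamentalRep (Fin 2)) β')) - ∫ ω, f (U s.toNNReal ω) ∂P| ≤ δ / 2 := by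
      intro s hs
      have hs2 : 2 ≤ s := hTc2.trans hs
      have hu : Real.log (Real.sqrt (2 * (366 * |β'| * (L : ℝ) ^ 3 + 3 * Real.log (3 / 2) * (L : ℝ) ^ 3 + Real.log 2)) / (δ / 2)) / (2 * ((1 / 2 : ℝ) * Real.exp (-(|β'| * (4 * (Fintype.card (Plaquette 3 L) : ℝ)))))) ≤ ((s - 2).toNNReal : ℝ) := by
        rw [Real.coe_toNNReal _ (by linarith), hSdef, hρdef]
        have e : S / (δ / 2) = 2 * S / δ := by field_simp
        rw [e]
        have : Tc - 2 = Real.log (2 * S / δ) / (2 * ρ) := by rw [hTc]; ring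
        linarith
      have h := wilson_coldStart_mixingTime_allCoupling_explicit L β' z hW hU0 hU (half_pos hδ) ((s - 2).toNNReal) hu hfm hfb
      rw [two_add_toNNReal_sub_two hs2] at h
      rw [abs_sub_comm]
      exact h
    exact abs_sub_inv_mul_integral_le_of_le hTcpos hδ le_rfl he1 hgb hgi hmix hT

/-! ## §3. The hypothesis (M) of the rung, discharged with explicit constants -/

/-- ★★ **(M) — pointwise mixing of the cold start at every fixed cut-off, EXPLICITLY**: the hypothesis `hM` of
`fixedCutoffMixing_of_pointwiseMixing` (g8), for every `L`, `β'`, measurable `|f| ≤ 1` and `δ > 0`, with the explicit threshold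
`t₀ = 2 + log(√(2B_L)/δ)/(2ρ_L)` (the canonical cold-start solution on the product Wiener space as witness; any solution would do).
[cite: BakryGentilLedoux2014, Thm 5.2.1] -/
theorem pointwiseMixing_holds_explicit :
    ∀ (L : ℕ) [NeZero L] (β' : ℝ)
      (f : GaugeConfig 3 L (Matrix.specialUnitaryGroup (Fin 2) ℂ) → ℝ), Measurable f → (∀ V, |f V| ≤ 1) →
      ∀ δ : ℝ, 0 < δ → ∃ t₀ : ℝ, ∀ t : ℝ, t₀ ≤ t →
        ∃ (Ω : Type) (_mΩ : MeasurableSpace Ω) (P : Measure Ω) (_hP : IsProbabilityMeasure P)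
          (W : ℝ≥0 → Ω → (Edge 3 L × NoiseIdx 2 → ℝ)) (hW : IsFlatBrownian W P)
          (U : ℝ≥0 → Ω → GaugeConfig 3 L (Matrix.specialUnitaryGroup (Fin 2) ℂ)),
          (∀ ω, U 0 ω = fun _ => 1) ∧
          (latticeLangevinDynamics (fundamentalLatticeRep 2) β').IsSolution (fundamentalRep (Fin 2))
            hW.natFiltration P W U ∧
          |(∫ V, f V ∂(wilsonMeasure (d := 3) (L := L) (fundamentalRep (Fin 2)) β')) -
              ∫ ω, f (U t.toNNReal ω) ∂P| ≤ δ := by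
  intro L _ β' f hfm hfb δ hδ
  haveI := isProbabilityMeasure_piWiener (Edge 3 L × NoiseIdx 2)
  have hWc := isFlatBrownian_piWiener 3 L (NoiseIdx 2)
  obtain ⟨Uc, hUc0, hUc⟩ := solution_from_start hWc β' (fun _ => 1)
  refine ⟨max 2 (2 + Real.log (Real.sqrt (2 * (366 * |β'| * (L : ℝ) ^ 3 + 3 * Real.log (3 / 2) * (L : ℝ) ^ 3 + Real.log 2)) / δ) / (2 * ((1 / 2 : ℝ) * Real.exp (-(|β'| * (4 * (Fintype.card (Plaquette 3 L) : ℝ))))))), fun t ht => ?_⟩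
  have ht2 : 2 ≤ t := (le_max_left _ _).trans ht
  refine ⟨_, inferInstance, _, inferInstance, _, hWc, Uc, hUc0, hUc, ?_⟩
  have hu : Real.log (Real.sqrt (2 * (366 * |β'| * (L : ℝ) ^ 3 + 3 * Real.log (3 / 2) * (L : ℝ) ^ 3 + Real.log 2)) / δ) / (2 * ((1 / 2 : ℝ) * Real.exp (-(|β'| * (4 * (Fintype.card (Plaquette 3 L) : ℝ)))))) ≤ ((t - 2).toNNReal : ℝ) := by
    rw [Real.coe_toNNReal _ (by linarith)]
    linarith [(le_max_right _ _).trans ht]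
  have h := wilson_coldStart_mixingTime_allCoupling_explicit L β' (fun _ => 1) hWc hUc0 hUc hδ ((t - 2).toNNReal) hu hfm hfb
  rw [two_add_toNNReal_sub_two ht2] at h
  rw [abs_sub_comm]
  exact h

end Summit.QuantumFields.YangMills.Theorems.ColdStartUniversality
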